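import Summits.Ventures.PackingBounds.Energy.TenPointCkSixGramDataY1
import Summits.Ventures.PackingBounds.Energy.TenPointCkSixGramDataY2
import Summits.Ventures.PackingBounds.Energy.TenPointCkSixGramDataY3
import Summits.Ventures.PackingBounds.Energy.TenPointCkSixGramDataY4
import Summits.Ventures.PackingBounds.Energy.TenPointCkSixGramDataY5
import HarnessLib

/-!
# Integer Gram data `S·Y = L Lᵀ + E` (S and the rows of S·Y: the table (collector of 5 part modules)) of the 153 × 153 SOS block of the exact sharp three-point certificate
# `e3pt-sharp-n4N10ck6d8-rat.json` (two orthogonal regular pentagons (4,10); ten points on S³, single SOS term, d = 8)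

Framing: lottery ticket; floor = certified bounds/negative ranges. Venture `PackingBounds`, cell `pub-packcert`, energy family E3PT
(pub-packcert-energy gen 15; KERNEL-D6 data route). `yW6` = S·Y (S = `scaleW6` = lcm of denominators · 2^40), `lW6` = rounded scaled Cholesky
factor, `eW6` = S·Y − lW6·lW6ᵀ (exact; symmetric, diagonally dominant). Checked by `decide +kernel` with `GramData.checkRows` / `checkDD`
in `TenPointCkSixGramFacts*`; generator `pub-packcert-energy/code/e3pt/g15/e3pt_lean_n4y.py`. (Rows split in independent modules for the gate's request-size limit; one collector per table.)
-/

namespace Summit.Ventures.PackingBounds.Energy.PentagonsSixD8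

/-- The scale `S` (`yW6 = S·Y`). -/
def scaleW6 : ℤ := 25353012004564588029934064107520

/-- data rows. -/
def yW6 : List (List ℤ) := [yW60, yW61, yW62, yW63, yW64, yW65, yW66, yW67, yW68, yW69, yW610, yW611, yW612, yW613, yW614, yW615, yW616, yW617, yW618, yW619, yW620, yW621, yW622, yW623, yW624, yW625, yW626, yW627, yW628, yW629, yW630, yW631, yW632, yW633, yW634, yW635, yW636, yW637, yW638, yW639, yW640, yW641, yW642, yW643, yW644, yW645, yW646, yW647, yW648, yW649, yW650, yW651, yW652, yW653, yW654, yW655, yW656, yW657, yW658, yW659, yW660, yW661, yW662, yW663, yW664, yW665, yW666, yW667, yW668, yW669, yW670, yW671, yW672, yW673, yW674, yW675, yW676, yW677, yW678, yW679, yW680, yW681, yW682, yW683, yW684, yW685, yW686, yW687, yW688, yW689, yW690, yW691, yW692, yW693, yW694, yW695, yW696, yW697, yW698, yW699, yW6100, yW6101, yW6102, yW6103, yW6104, yW6105, yW6106, yW6107, yW6108, yW6109, yW6110, yW6111, yW6112, yW6113, yW6114, yW6115, yW6116, yW6117, yW6118, yW6119, yW6120, yW6121, yW6122, yW6123, yW6124,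 yW6125, yW6126, yW6127, yW6128, yW6129, yW6130, yW6131, yW6132, yW6133, yW6134, yW6135, yW6136, yW6137, yW6138, yW6139, yW6140, yW6141, yW6142, yW6143, yW6144, yW6145, yW6146, yW6147, yW6148, yW6149, yW6150, yW6151, yW6152]

end Summit.Ventures.PackingBounds.Energy.PentagonsSixD8
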